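/-
Copyright (c) 2026 the pub-hodgecm-mathlib formalisation cell (harness21).  Prover seat hodgecm-mathlib-K2E5-p04 (g0),
Track B «K2-LIT» ∕ h413, engine E5 «TamagawaUnitary», unit G, DEALS BATCH #9 (6): DEFS LEAF #3m, ED. 1 (the finite-adelic restricted product).  2026-09-03/04.
-/
import Summits.HodgeConjecture.HodgeConjecture.Theorems.K2E5QuatAdelicNrdDefs        -- ★ #3i: `quatAdelicUnits`, `quatAdelicUnitsToLocal`, `quatAdelicUnitsLevel` (+ ★ #3d `quatModelUnits`, ★ #3f `quatLocalUnits(Level)`)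
import Literature.NumberTheory.Automorphic.UnitaryGroupRestrictedProduct              -- ★ `conjFiniteAdele`, `glRegroup`, `Matrix.finiteAdele_eq_iff_forall`, `ContinuousMulEquiv.restrictSubgroup`, Cutout
import Literature.NumberTheory.Automorphic.UnitaryGroupPureTensorEulerProduct          -- ★ `locallyCompactSpace_gl_adicCompletion`, `secondCountableTopology_gl_adicCompletion` (+ ★ `RestrictedProduct.Haar` for ED. 3)
import HarnessLib

/-!
# K2 ∕ E5 — DEFS LEAF #3m, ED. 1: `(D_h ⊗ 𝔸_{L⁺,f})^× ≃ₜ* ∏'_v ((D_v)^× : Λ_v^×)` — the finite-adelic unit group of the matrix model as a RESTRICTED PRODUCT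

Engine E5 «TamagawaUnitary» models the CM quaternion algebra `D_h` over `L⁺` by the matrices
`D(σ, h) = {x ∈ M₂(A) : (σ x)ᵀ h = h · adj x}` (★ #3d `quatModel(Units)`), with `σ = c ⊗ 1` on `A = L ⊗_{L⁺} (·)`.  ★ #3f
put the LOCAL unit groups `(D_v)^× = quatLocalUnits L Ha v ≤ GL₂(Π_{w∣v} L_w)` and their integral points `Λ_v^× = quatLocalUnitsLevel`,
★ #3l the local Haar data, ★ #3d∕#3i the ADELIC unit group `quatAdelicUnits ≤ GL₂(𝔸_L)`, its local projections `quatAdelicUnitsToLocal v`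
and its finite level.  This leaf (first of three files of DEFS LEAF #3m, DEALS BATCH #9 (6) of K2E5-plan (g2)) supplies the missing
structural identification behind every Euler product of the engine:

* §1 `quatFinAdelicUnits L Ha ≤ GL₂(𝔸_{L,f})` — the finite-adelic unit group (★ #3d `quatModelUnits` over `FiniteAdeleRing`, ★
  `conjFiniteAdele`, ★ `finiteAdelicForm`), with the placewise membership criterion `mem_quatFinAdelicUnits_iff_forall`.
* §2 the FACTOR carrier `quatLocalPi L Ha v ≤ Π_{w∣v} GL₂(L_w)` (★ `LocalGLPi`), `quatLocalPiEquiv v : quatLocalPi v ≃ₜ* quatLocalUnits v`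
  (restriction of ★ `localGLPiEquiv`), the fibrewise criterion `mem_quatLocalPi_iff`, and the integral points `quatLocalPiInt v`
  (`= inH localIntBox quatLocalPi v`, compact open) with `mem_quatLocalPiInt_iff_quatLocalPiEquiv_mem : u ∈ quatLocalPiInt v ↔
  quatLocalPiEquiv u ∈ quatLocalUnitsLevel v` — so ★ #3f∕#3l's objects are read on the factors.
* §3 **`quatFinAdelicEquiv : ↥(quatFinAdelicUnits L Ha) ≃ₜ* Πʳ v, [↥(quatLocalPi L Ha v), quatLocalPiInt L Ha v]`** — ★ `glRegroup`
  (`GL₂(𝔸_{L,f}) ≃ₜ* ∏'_v Π_{w∣v} GL₂(L_w)`) restricted to the fibrewise cut-out (`mem_quatFinAdelicUnits_iff_glRegroup_mem_cutout`), then ★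
  `cutoutEquiv`; coordinates `quatFinAdelicEquiv_apply_coe` (`rfl`), the projections `quatEvalPlace v` (continuous homs), their reading
  on the matrix carrier `coe_quatLocalPiEquiv_quatEvalPlace_apply` (entry `(i,j,w)` = image of `g_{ij}` in `L_w`), and
  `eventually_quatEvalPlace_mem` (almost all components integral).
* §4 the finite level `quatFinAdelicUnitsLevel = quatFinAdelicUnits ∩ GL₂(𝒪̂_L)` (compact open) and its FACTORISATION
  `mem_quatFinAdelicUnitsLevel_iff_forall(_level) : g ∈ K_f ↔ ∀ v, g_v ∈ Λ_v^×`.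
* §5 local compactness ∕ second countability of the factors, of the restricted product and of `quatFinAdelicUnits` (for ED. 3).

Siblings (same deal): ED. 2 `K2E5QuatAdelicProdDecomposition` (`quatAdelicUnits ≃ₜ* arch × quatFinAdelicUnits`, compatibility of
`quatAdelicUnitsToLocal v` with `quatLocalPiEquiv v ∘ quatEvalPlace v`), ED. 3 `K2E5QuatUnitsProductHaar` (`quatUnitsProductHaar` as the
transported `μ_∞ ⊗ rpMeasure (λ_v • quatLocalMulHaar)`).

The construction is the verbatim twin of the tree's unitary-group template ★ `Literature/NumberTheory/Automorphic/UnitaryGroupRestrictedProduct`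
(§§3, 5, 6) and ★ `UnitaryGroupLocalFactors` (`localPi`, `localInt`), with the unitary relation `(c g)ᵀ J g = J` replaced by the model's
`(c g)ᵀ h = h · adj g`; mathematically it is Platonov–Rapinchuk's description of the adelic points of a linear algebraic group as a
restricted product with respect to the integral points of almost all places [cite: PlatonovRapinchuk1994, §5.1], applied to `D_h^×`
[cite: VignerasLNM800, Ch. III §1], with the integral level of [cite: BorelJacquet1979, §4.1].

HONEST LABEL: HC_CM is proved only modulo the 7 printed citations (2 remaining named inputs: hLiu418 = stmt-HodgeConjecture-24832,
h413 = stmt-HodgeConjecture-24833) until rung 0 closes.  This file is definitions + structural lemmas only (helper lane, `--supports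
stmt-HodgeConjecture-24833`); it closes no item.  RULES KEPT: no `instance`, no `notation`, no `sorry`, no `def … : Prop` hypothesis; every
declaration carries a docstring; axioms ⊆ {propext, Classical.choice, Quot.sound}.
-/

set_option autoImplicit false
set_option linter.dupNamespace false

noncomputable section

namespace Summit.HodgeConjecture.HodgeConjecture.Cruxes.H413.K2E5QuatAdelicRestrictedProduct

open NumberField IsDedekindDomain Topology Filter
open Literature.NumberTheory.Automorphic Literature.NumberTheory.Automorphic.UnitaryGroup
open Literature.NumberTheory.Weil1982.UnitaryFinTopForm
open Literature.Topology.Algebra.RestrictedProduct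
open Summit.HodgeConjecture.HodgeConjecture.Cruxes.H413.K2E5QuatAdelicMatrixModel
open Summit.HodgeConjecture.HodgeConjecture.Cruxes.H413.K2E5QuatLocalMeasure
open scoped Matrix MatrixGroups RestrictedProduct

variable (L : Type) [Field L] [NumberField L] [IsCMField L] (Ha : Matrix (Fin 2) (Fin 2) L)

/-! ## §1 The finite-adelic matrix model `D_{h,f} = D(c ⊗ 1, h ⊗ 1) ≤ M₂(𝔸_{L,f})` and its unit group -/

/-- **`(D_h ⊗ 𝔸_{L⁺,f})^× ≤ GL₂(𝔸_{L,f})`** — the unit group of the finite-adelic matrix model `{x ∈ M₂(𝔸_{L,f}) : ((c ⊗ 1)x)ᵀ (h ⊗ 1) = (h ⊗ 1) adj x}` (★ #3d `quatModelUnits` over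
the finite adèle ring with ★ `conjFiniteAdele` and ★ `finiteAdelicForm`; the finite part of ★ #3d `quatAdelicUnits`). [cite: VignerasLNM800, Ch. III §1 (X_A^×)] -/
def quatFinAdelicUnits : Subgroup (GL (Fin 2) (FiniteAdeleRing (𝓞 L) L)) :=
  quatModelUnits (conjFiniteAdele (↥(maximalRealSubfield L)) L (IsCMField.complexConj L)) (finiteAdelicForm L 2 Ha)

/-- Membership: `((c ⊗ 1)g)ᵀ (h ⊗ 1) = (h ⊗ 1) adj g`. [cite: VignerasLNM800, Ch. III §1] -/
theorem mem_quatFinAdelicUnits_iff (g : GL (Fin 2) (FiniteAdeleRing (𝓞 L) L)) :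
    g ∈ quatFinAdelicUnits L Ha ↔
      (((g : GL (Fin 2) (FiniteAdeleRing (𝓞 L) L)) : Matrix (Fin 2) (Fin 2) (FiniteAdeleRing (𝓞 L) L)).map
          (conjFiniteAdele (↥(maximalRealSubfield L)) L (IsCMField.complexConj L)))ᵀ * finiteAdelicForm L 2 Ha =
        finiteAdelicForm L 2 Ha * Matrix.adjugate ((g : GL (Fin 2) (FiniteAdeleRing (𝓞 L) L)) : Matrix (Fin 2) (Fin 2) (FiniteAdeleRing (𝓞 L) L)) :=
  mem_quatModelUnits_iff _ _ g

/-- **Placewise membership criterion**: `g ∈ (D_h ⊗ 𝔸_{L⁺,f})^×` iff at every finite place `w` of `L`: `(c_* g_{c⁻¹w})ᵀ h = h · adj g_w` in `M₂(L_w)` (★ `Matrix.finiteAdele_eq_iff_forall`,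
★ `map_conjFiniteAdele_map_eval`, Mathlib `RingHom.map_adjugate`). [cite: PlatonovRapinchuk1994, §5.1] -/
theorem mem_quatFinAdelicUnits_iff_forall (g : GL (Fin 2) (FiniteAdeleRing (𝓞 L) L)) :
    g ∈ quatFinAdelicUnits L Ha ↔ ∀ w : HeightOneSpectrum (𝓞 L),
      (((GLn.evalAt 2 L ((IsCMField.complexConj L)⁻¹ • w) g : GL (Fin 2) (((IsCMField.complexConj L)⁻¹ • w).adicCompletion L)) :
            Matrix (Fin 2) (Fin 2) (((IsCMField.complexConj L)⁻¹ • w).adicCompletion L)).map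
          (galAdicCompletionMap (IsCMField.complexConj L) (smul_inv_smul (IsCMField.complexConj L) w)))ᵀ * placeForm Ha w =
        placeForm Ha w * Matrix.adjugate ((GLn.evalAt 2 L w g : GL (Fin 2) (w.adicCompletion L)) : Matrix (Fin 2) (Fin 2) (w.adicCompletion L)) := by
  rw [mem_quatFinAdelicUnits_iff, Matrix.finiteAdele_eq_iff_forall]
  refine forall_congr' fun w => ?_
  simp only [← RingHom.mapMatrix_apply, map_mul, RingHom.map_adjugate]
  simp only [RingHom.mapMatrix_apply, Matrix.transpose_map, map_conjFiniteAdele_map_eval, map_eval_eq_evalAt, finiteAdelicForm_map_eval]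

variable (v : HeightOneSpectrum (𝓞 ↥(maximalRealSubfield L)))

/-! ## §2 The factor carrier at a place: `(D_v)^× ≤ Π_{w ∣ v} GL₂(L_w)` and its identification with ★ #3f's matrix carrier -/

/-- **`(D_v)^×` on the FACTOR carrier `Π_{w ∣ v} GL₂(L_w)`** (★ `LocalGLPi L 2 v`): ★ #3f's `quatLocalUnits L Ha v ≤ GL₂(E_v)` (`E_v = Π_{w∣v} L_w`) pulled back along ★ `localGLPiEquiv v`
(`GL₂(Π_w L_w) ≃ Π_w GL₂(L_w)`) — the exact twin of ★ `UnitaryGroup.localPi`. [cite: PlatonovRapinchuk1994, §5.1] [cite: VignerasLNM800, Ch. II §1 (X_v)] -/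
def quatLocalPi : Subgroup (LocalGLPi L 2 v) :=
  (quatLocalUnits L Ha v).comap (localGLPiEquiv L 2 v).symm.toMulEquiv.toMonoidHom

/-- Membership in `quatLocalPi` is membership of the regrouped matrix in `(D_v)^×` (definitional). [folklore] -/
theorem mem_quatLocalPi_iff_symm_mem (u : LocalGLPi L 2 v) : u ∈ quatLocalPi L Ha v ↔ (localGLPiEquiv L 2 v).symm u ∈ quatLocalUnits L Ha v :=
  Iff.rfl

/-- `localGLPiEquiv g ∈ quatLocalPi ↔ g ∈ (D_v)^×`. [folklore] -/
theorem localGLPiEquiv_mem_quatLocalPi_iff (g : GL (Fin 2) (LocalRing L v)) : localGLPiEquiv L 2 v g ∈ quatLocalPi L Ha v ↔ g ∈ quatLocalUnits L Ha v := by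
  rw [mem_quatLocalPi_iff_symm_mem, ContinuousMulEquiv.symm_apply_apply]

/-- **Fibrewise membership criterion** on the factor carrier: `u = (u_w)_{w ∣ v}` lies in `(D_v)^×` iff for every `w ∣ v`: `(c_* u_{c⁻¹w})ᵀ · h = h · adj u_w` in `M₂(L_w)` (the twin of ★
`UnitaryGroup.mem_localPi_iff`; ★ `GLn.map_piEquiv_symm`, ★ `localForm_map_eval`, ★ `Matrix.eq_iff_forall_map_evalRingHom`, Mathlib `RingHom.map_adjugate`). [cite: PlatonovRapinchuk1994, §5.1] -/
theorem mem_quatLocalPi_iff (u : LocalGLPi L 2 v) :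
    u ∈ quatLocalPi L Ha v ↔ ∀ w : PlacesOver L v,
      (((u (PlacesOver.galInv (IsCMField.complexConj L) w) : GL (Fin 2) ((PlacesOver.galInv (IsCMField.complexConj L) w).1.adicCompletion L)) :
            Matrix (Fin 2) (Fin 2) ((PlacesOver.galInv (IsCMField.complexConj L) w).1.adicCompletion L)).map
          (galAdicCompletionMap (IsCMField.complexConj L) (smul_inv_smul (IsCMField.complexConj L) w.1)))ᵀ * placeForm Ha w.1 =
        placeForm Ha w.1 * Matrix.adjugate ((u w : GL (Fin 2) (w.1.adicCompletion L)) : Matrix (Fin 2) (Fin 2) (w.1.adicCompletion L)) := by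
  rw [mem_quatLocalPi_iff_symm_mem, mem_quatLocalUnits_iff, mem_quatLocal_iff, localForm]
  set M : Matrix (Fin 2) (Fin 2) (LocalRing L v) := Units.val ((localGLPiEquiv L 2 v).symm u) with hM
  have hev : ∀ w : PlacesOver L v,
      M.map (Pi.evalRingHom (fun w : PlacesOver L v => w.1.adicCompletion L) w) =
        ((u w : GL (Fin 2) (w.1.adicCompletion L)) : Matrix (Fin 2) (Fin 2) (w.1.adicCompletion L)) :=
    fun w => GLn.map_piEquiv_symm _ _ u w
  have hconj : ∀ w : PlacesOver L v,
      (M.map (conjLocal L (IsCMField.complexConj L) v)).map (Pi.evalRingHom (fun w : PlacesOver L v => w.1.adicCompletion L) w) =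
        (((u (PlacesOver.galInv (IsCMField.complexConj L) w) : GL (Fin 2) ((PlacesOver.galInv (IsCMField.complexConj L) w).1.adicCompletion L)) :
            Matrix (Fin 2) (Fin 2) ((PlacesOver.galInv (IsCMField.complexConj L) w).1.adicCompletion L)).map
          (galAdicCompletionMap (IsCMField.complexConj L) (smul_inv_smul (IsCMField.complexConj L) w.1))) := by
    intro w
    rw [← hev (PlacesOver.galInv (IsCMField.complexConj L) w), Matrix.map_map, Matrix.map_map]
    rfl
  rw [Matrix.eq_iff_forall_map_evalRingHom]
  refine forall_congr' fun w => ?_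
  simp only [← RingHom.mapMatrix_apply, map_mul, RingHom.map_adjugate]
  simp only [RingHom.mapMatrix_apply, Matrix.transpose_map, hconj, hev, localForm_map_eval]

/-- `quatLocalPi` is closed in `Π_{w ∣ v} GL₂(L_w)` (★ `isClosed_quatLocalUnits`). [cite: PlatonovRapinchuk1994, §3.3] -/
theorem isClosed_quatLocalPi : IsClosed (quatLocalPi L Ha v : Set (LocalGLPi L 2 v)) :=
  (isClosed_quatLocalUnits L Ha v).preimage (localGLPiEquiv L 2 v).symm.continuous

/-- **`(D_v)^×` in its two forms**: `quatLocalPi L Ha v ≃ₜ* ↥(quatLocalUnits L Ha v)` (restriction of `Π_w GL₂(L_w) ≃ GL₂(Π_w L_w)`; the twin of ★ `localPiEquiv`) — through it every object of ★ #3f∕#3l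
(`quatLocalUnitsLevel`, `quatLocalModule`, `quatLocalMulHaar`, …) is read on the restricted-product factors. [cite: PlatonovRapinchuk1994, §5.1] -/
def quatLocalPiEquiv : ↥(quatLocalPi L Ha v) ≃ₜ* ↥(quatLocalUnits L Ha v) :=
  ContinuousMulEquiv.restrictSubgroup (localGLPiEquiv L 2 v).symm (quatLocalPi L Ha v) (quatLocalUnits L Ha v)
    fun u => mem_quatLocalPi_iff_symm_mem L Ha v u

/-- Underlying matrices: `quatLocalPiEquiv u = (localGLPiEquiv v).symm u`. [folklore] -/
@[simp] theorem coe_quatLocalPiEquiv_apply (u : ↥(quatLocalPi L Ha v)) :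
    ((quatLocalPiEquiv L Ha v u : ↥(quatLocalUnits L Ha v)) : GL (Fin 2) (LocalRing L v)) = (localGLPiEquiv L 2 v).symm u.1 := rfl

/-- Underlying tuples: `quatLocalPiEquiv.symm g = localGLPiEquiv v g`. [folklore] -/
@[simp] theorem coe_quatLocalPiEquiv_symm_apply (g : ↥(quatLocalUnits L Ha v)) :
    (((quatLocalPiEquiv L Ha v).symm g : ↥(quatLocalPi L Ha v)) : LocalGLPi L 2 v) = localGLPiEquiv L 2 v g.1 := rfl

/-- **The integral points `Λ_v^×` on the factor carrier**: `quatLocalPiEquiv u ∈ Λ_v^×` iff all components `u_w ∈ GL₂(𝒪_w)` (★ `localIntBox`) — because `Λ_v^× = (D_v)^× ∩ {g, g⁻¹ integral}` and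
integrality of a matrix over `Π_w L_w` is integrality of every component. [cite: PlatonovRapinchuk1994, §3.3] -/
theorem quatLocalPiEquiv_mem_level_iff (u : ↥(quatLocalPi L Ha v)) :
    ((quatLocalPiEquiv L Ha v u : ↥(quatLocalUnits L Ha v)) : GL (Fin 2) (LocalRing L v)) ∈ quatLocalUnitsLevel L Ha v ↔
      (u : LocalGLPi L 2 v) ∈ localIntBox L 2 v := by
  rw [coe_quatLocalPiEquiv_apply, mem_quatLocalUnitsLevel_iff,
    show ((u : LocalGLPi L 2 v) ∈ localIntBox L 2 v) ↔ ∀ w : PlacesOver L v, (u : LocalGLPi L 2 v) w ∈ glInt 2 (w.1.adicCompletion L) from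
      mem_fibSubgroup_iff _ _ _]
  -- the components of `u` are the components of the regrouped matrix `g := (localGLPiEquiv v).symm u`
  have hu : (u : LocalGLPi L 2 v) = localGLPiEquiv L 2 v ((localGLPiEquiv L 2 v).symm u.1) := ((localGLPiEquiv L 2 v).apply_symm_apply u.1).symm
  have hcomp : ∀ (w : PlacesOver L v) (i j : Fin 2),
      (((u : LocalGLPi L 2 v) w : GL (Fin 2) (w.1.adicCompletion L)) : Matrix (Fin 2) (Fin 2) (w.1.adicCompletion L)) i j =
        ((((localGLPiEquiv L 2 v).symm u.1 : GL (Fin 2) (LocalRing L v)) : Matrix (Fin 2) (Fin 2) (LocalRing L v)) i j) w := by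
    intro w i j
    conv_lhs => rw [hu, GLn.coe_piEquiv_apply, Matrix.map_apply]
    rfl
  have hcompi : ∀ (w : PlacesOver L v) (i j : Fin 2),
      ((((u : LocalGLPi L 2 v) w)⁻¹ : GL (Fin 2) (w.1.adicCompletion L)) : Matrix (Fin 2) (Fin 2) (w.1.adicCompletion L)) i j =
        (((((localGLPiEquiv L 2 v).symm u.1)⁻¹ : GL (Fin 2) (LocalRing L v)) : Matrix (Fin 2) (Fin 2) (LocalRing L v)) i j) w := by
    intro w i j
    conv_lhs => rw [← Pi.inv_apply, hu, ← map_inv, GLn.coe_piEquiv_apply, Matrix.map_apply]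
    rfl
  simp only [mem_glInt_iff, Literature.NumberTheory.Weil1982.UnitaryFinTopForm.mem_intMatrices_iff, mem_localIntegers_iff]
  constructor
  · rintro ⟨-, h1, h2⟩ w
    exact ⟨fun i j => by rw [hcomp]; exact h1 i j w, fun i j => by rw [hcompi]; exact h2 i j w⟩
  · intro h
    refine ⟨(mem_quatLocalPi_iff_symm_mem L Ha v _).1 u.2, fun i j w => ?_, fun i j w => ?_⟩
    · rw [← hcomp]; exact (h w).1 i j
    · rw [← hcompi]; exact (h w).2 i j

/-- **`Λ_v^×` on the factor carrier** as a subgroup of `quatLocalPi L Ha v`: the trace of the box `Π_{w ∣ v} GL₂(𝒪_w)` (★ `localIntBox`) — spelled `inH` so that Mathlib's restricted-product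
instances (via ★ `RestrictedProduct.fact_isOpen_inH` and ★ `fact_isOpen_localIntBox`) apply verbatim; the twin of ★ `UnitaryGroup.localInt`. [cite: PlatonovRapinchuk1994, §5.1] -/
abbrev quatLocalPiInt : Subgroup ↥(quatLocalPi L Ha v) :=
  inH (fun v => localIntBox L 2 v) (fun v => quatLocalPi L Ha v) v

/-- Membership in `quatLocalPiInt`: every component `u_w ∈ GL₂(𝒪_w)`. [folklore] -/
theorem mem_quatLocalPiInt_iff (u : ↥(quatLocalPi L Ha v)) :
    u ∈ quatLocalPiInt L Ha v ↔ ∀ w : PlacesOver L v, (u : LocalGLPi L 2 v) w ∈ glInt 2 (w.1.adicCompletion L) := by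
  rw [Subgroup.mem_subgroupOf]
  exact mem_fibSubgroup_iff _ _ _

/-- **`quatLocalPiInt` IS ★ #3f's `Λ_v^×`** under `quatLocalPiEquiv`: `u ∈ quatLocalPiInt v ↔ quatLocalPiEquiv u ∈ quatLocalUnitsLevel v`. [cite: PlatonovRapinchuk1994, §3.3] -/
theorem mem_quatLocalPiInt_iff_quatLocalPiEquiv_mem (u : ↥(quatLocalPi L Ha v)) :
    u ∈ quatLocalPiInt L Ha v ↔
      ((quatLocalPiEquiv L Ha v u : ↥(quatLocalUnits L Ha v)) : GL (Fin 2) (LocalRing L v)) ∈ quatLocalUnitsLevel L Ha v := by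
  rw [quatLocalPiEquiv_mem_level_iff]
  rfl

/-- In the other direction: `g ∈ Λ_v^× ↔ (quatLocalPiEquiv v).symm g ∈ quatLocalPiInt v` for `g ∈ (D_v)^×`. [cite: PlatonovRapinchuk1994, §3.3] -/
theorem quatLocalPiEquiv_symm_mem_quatLocalPiInt_iff (g : ↥(quatLocalUnits L Ha v)) :
    (quatLocalPiEquiv L Ha v).symm g ∈ quatLocalPiInt L Ha v ↔ (g : GL (Fin 2) (LocalRing L v)) ∈ quatLocalUnitsLevel L Ha v := by
  rw [mem_quatLocalPiInt_iff_quatLocalPiEquiv_mem, ContinuousMulEquiv.apply_symm_apply]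

/-- `quatLocalPiInt v` is open in `quatLocalPi v`. [cite: PlatonovRapinchuk1994, §5.1] -/
theorem isOpen_quatLocalPiInt : IsOpen (quatLocalPiInt L Ha v : Set ↥(quatLocalPi L Ha v)) :=
  isOpen_inH _ _ (fun v => isOpen_localIntBox L 2 v) v

/-- `quatLocalPiInt v` is compact (closed `quatLocalPi v` meets the compact box `Π_w GL₂(𝒪_w)`). [cite: PlatonovRapinchuk1994, §5.1] -/
theorem isCompact_quatLocalPiInt : IsCompact (quatLocalPiInt L Ha v : Set ↥(quatLocalPi L Ha v)) := by
  have h : (quatLocalPiInt L Ha v : Set ↥(quatLocalPi L Ha v)) = ((↑) : ↥(quatLocalPi L Ha v) → LocalGLPi L 2 v) ⁻¹' (localIntBox L 2 v : Set (LocalGLPi L 2 v)) := by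
    ext x; simp [Subgroup.mem_subgroupOf]
  rw [h]
  exact (isClosed_quatLocalPi L Ha v).isClosedEmbedding_subtypeVal.isCompact_preimage (isCompact_localIntBox L 2 v)

/-! ## §3 The restricted-product decomposition `(D_h ⊗ 𝔸_{L⁺,f})^× ≃ₜ* ∏'_v ((D_v)^× : Λ_v^×)` -/

/-- Under the regrouping `GL₂(𝔸_{L,f}) ≃ ∏'_v Π_{w∣v} GL₂(L_w)` (★ `glRegroup`), `(D_h ⊗ 𝔸_{L⁺,f})^×` is the fibrewise cut-out by the `(D_v)^×` (twin of ★
`mem_finAdelic_iff_glRegroup_mem_cutout`). [cite: PlatonovRapinchuk1994, §5.1] -/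
theorem mem_quatFinAdelicUnits_iff_glRegroup_mem_cutout (g : GL (Fin 2) (FiniteAdeleRing (𝓞 L) L)) :
    g ∈ quatFinAdelicUnits L Ha ↔
      glRegroup (↥(maximalRealSubfield L)) L 2 g ∈ cutout (fun v => localIntBox L 2 v) (fun v => quatLocalPi L Ha v) := by
  rw [mem_cutout_iff, mem_quatFinAdelicUnits_iff_forall]
  simp only [mem_quatLocalPi_iff, glRegroup_apply_apply]
  constructor
  · intro h v w
    exact h w.1
  · intro h w
    exact h (w.under (𝓞 ↥(maximalRealSubfield L))) ⟨w, rfl⟩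

/-- **MAIN DEFINITION. `(D_h ⊗ 𝔸_{L⁺,f})^× ≃ₜ* ∏'_v ((D_v)^× : Λ_v^×)`** as topological groups: the finite-adelic unit group of the matrix model is the restricted product over the
finite places `v` of `L⁺` of the local unit groups `(D_v)^×` (`quatLocalPi v ≃ₜ* quatLocalUnits v`) with respect to the compact open `Λ_v^×` (`quatLocalPiInt v`) — ★ `glRegroup`
restricted to the cut-out, then ★ `cutoutEquiv`; the twin of ★ `UnitaryGroup.finAdelicEquiv`. [cite: PlatonovRapinchuk1994, §5.1] [cite: VignerasLNM800, Ch. III §1] -/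
def quatFinAdelicEquiv : ↥(quatFinAdelicUnits L Ha) ≃ₜ*
    Πʳ v : HeightOneSpectrum (𝓞 ↥(maximalRealSubfield L)), [↥(quatLocalPi L Ha v), quatLocalPiInt L Ha v] :=
  (ContinuousMulEquiv.restrictSubgroup (glRegroup (↥(maximalRealSubfield L)) L 2) (quatFinAdelicUnits L Ha)
      (cutout (fun v => localIntBox L 2 v) (fun v => quatLocalPi L Ha v))
      (mem_quatFinAdelicUnits_iff_glRegroup_mem_cutout L Ha)).trans
    (cutoutEquiv (fun v => localIntBox L 2 v) (fun v => quatLocalPi L Ha v)).symm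

/-- **Coordinates of `quatFinAdelicEquiv`**: the `v`-component of `g` is `(g_w)_{w ∣ v}` (definitional). [folklore] -/
@[simp] theorem quatFinAdelicEquiv_apply_coe (g : ↥(quatFinAdelicUnits L Ha)) (w : PlacesOver L v) :
    ((quatFinAdelicEquiv L Ha g v : ↥(quatLocalPi L Ha v)) : LocalGLPi L 2 v) w = GLn.evalAt 2 L w.1 g.1 := rfl

/-- **The projection `(D_h ⊗ 𝔸_{L⁺,f})^× →* (D_v)^×`** on the factor carrier, `g ↦ (g_w)_{w ∣ v}` (the `v`-component of `quatFinAdelicEquiv`). [folklore] -/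
def quatEvalPlace : ↥(quatFinAdelicUnits L Ha) →* ↥(quatLocalPi L Ha v) :=
  (RestrictedProduct.evalMonoidHom (fun v : HeightOneSpectrum (𝓞 ↥(maximalRealSubfield L)) => ↥(quatLocalPi L Ha v)) v).comp
    (quatFinAdelicEquiv L Ha).toMonoidHom

/-- `quatEvalPlace v g = quatFinAdelicEquiv g v` (definitional). [folklore] -/
theorem quatEvalPlace_apply (g : ↥(quatFinAdelicUnits L Ha)) : quatEvalPlace L Ha v g = quatFinAdelicEquiv L Ha g v := rfl

/-- Coordinates of `quatEvalPlace`. [folklore] -/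
@[simp] theorem coe_quatEvalPlace_apply (g : ↥(quatFinAdelicUnits L Ha)) (w : PlacesOver L v) :
    ((quatEvalPlace L Ha v g : ↥(quatLocalPi L Ha v)) : LocalGLPi L 2 v) w = GLn.evalAt 2 L w.1 g.1 := rfl

/-- `quatEvalPlace v` is continuous. [folklore] -/
theorem continuous_quatEvalPlace : Continuous (quatEvalPlace L Ha v) :=
  (RestrictedProduct.continuous_eval v).comp (quatFinAdelicEquiv L Ha).continuous

/-- **The `v`-component on ★ #3f's MATRIX carrier**: the entries of `quatLocalPiEquiv v (quatEvalPlace v g) ∈ (D_v)^× ≤ GL₂(Π_{w∣v} L_w)` are `(i, j, w) ↦ (g_w)_{ij}` — the image of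
`g_{ij} ∈ 𝔸_{L,f}` in `L_w` (so it is ★ #3i's `quatAdelicUnitsToLocal v` on the finite part; the full compatibility is ED. 2). [folklore] -/
theorem coe_quatLocalPiEquiv_quatEvalPlace_apply (g : ↥(quatFinAdelicUnits L Ha)) (i j : Fin 2) (w : PlacesOver L v) :
    (((quatLocalPiEquiv L Ha v (quatEvalPlace L Ha v g) : ↥(quatLocalUnits L Ha v)) : GL (Fin 2) (LocalRing L v)) :
        Matrix (Fin 2) (Fin 2) (LocalRing L v)) i j w =
      ((g.1 : GL (Fin 2) (FiniteAdeleRing (𝓞 L) L)) : Matrix (Fin 2) (Fin 2) (FiniteAdeleRing (𝓞 L) L)) i j w.1 := by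
  have h := congrFun (congrFun (GLn.map_piEquiv_symm _ _ ((quatEvalPlace L Ha v g : ↥(quatLocalPi L Ha v)) : LocalGLPi L 2 v) w) i) j
  rw [Matrix.map_apply, coe_quatEvalPlace_apply] at h
  exact h

/-- **Almost all components are integral**: `g_v ∈ Λ_v^×` for all but finitely many `v`. [cite: PlatonovRapinchuk1994, §5.1] -/
theorem eventually_quatEvalPlace_mem (g : ↥(quatFinAdelicUnits L Ha)) :
    ∀ᶠ v in cofinite, quatEvalPlace L Ha v g ∈ quatLocalPiInt L Ha v :=
  (quatFinAdelicEquiv L Ha g).2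

/-- `Λ_v^×`-membership of the `v`-component, entrywise: all `g_w ∈ GL₂(𝒪_w)`, `w ∣ v`. [folklore] -/
theorem quatEvalPlace_mem_iff (g : ↥(quatFinAdelicUnits L Ha)) :
    quatEvalPlace L Ha v g ∈ quatLocalPiInt L Ha v ↔ ∀ w : PlacesOver L v, GLn.evalAt 2 L w.1 g.1 ∈ glInt 2 (w.1.adicCompletion L) :=
  (mem_quatLocalPiInt_iff L Ha v _).trans (forall_congr' fun w => by rw [coe_quatEvalPlace_apply])

/-- The same read on ★ #3f's matrix carrier: `quatLocalPiEquiv v (g_v) ∈ quatLocalUnitsLevel v` for almost all `v`. [cite: PlatonovRapinchuk1994, §5.1] -/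
theorem eventually_quatLocalPiEquiv_quatEvalPlace_mem_level (g : ↥(quatFinAdelicUnits L Ha)) :
    ∀ᶠ v in cofinite, ((quatLocalPiEquiv L Ha v (quatEvalPlace L Ha v g) : ↥(quatLocalUnits L Ha v)) : GL (Fin 2) (LocalRing L v)) ∈
      quatLocalUnitsLevel L Ha v :=
  (eventually_quatEvalPlace_mem L Ha g).mono fun v hv => (mem_quatLocalPiInt_iff_quatLocalPiEquiv_mem L Ha v _).1 hv

/-! ## §4 The finite integral level `K_f = (D_h ⊗ 𝔸_{L⁺,f})^× ∩ GL₂(𝒪̂_L) = ∏_v Λ_v^×` -/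

/-- **The finite integral level `K_f := (D_h ⊗ 𝔸_{L⁺,f})^× ∩ GL₂(𝒪̂_L)`** (trace of ★ `glFiniteIntegralLevel 2 L`; the finite part of ★ #3i `quatAdelicUnitsLevel`).
[cite: BorelJacquet1979, §4.1] [cite: VignerasLNM800, Ch. III §1] -/
def quatFinAdelicUnitsLevel : Subgroup ↥(quatFinAdelicUnits L Ha) :=
  (glFiniteIntegralLevel 2 L).subgroupOf (quatFinAdelicUnits L Ha)

/-- Membership in `K_f` (definitional). [folklore] -/
theorem mem_quatFinAdelicUnitsLevel_iff (g : ↥(quatFinAdelicUnits L Ha)) :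
    g ∈ quatFinAdelicUnitsLevel L Ha ↔ (g : GL (Fin 2) (FiniteAdeleRing (𝓞 L) L)) ∈ glFiniteIntegralLevel 2 L :=
  Iff.rfl

/-- **`K_f` is factorizable: `K_f = ∏_v Λ_v^×`** — under `quatFinAdelicEquiv`, `g ∈ K_f` iff every `v`-component lies in `Λ_v^×` (★ `GLn.mem_glFiniteIntegralLevel_iff_forall_evalAt`,
regrouped over the places of `L⁺`). [cite: PlatonovRapinchuk1994, §5.1] -/
theorem mem_quatFinAdelicUnitsLevel_iff_forall (g : ↥(quatFinAdelicUnits L Ha)) :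
    g ∈ quatFinAdelicUnitsLevel L Ha ↔
      ∀ v : HeightOneSpectrum (𝓞 ↥(maximalRealSubfield L)), quatFinAdelicEquiv L Ha g v ∈ quatLocalPiInt L Ha v := by
  rw [mem_quatFinAdelicUnitsLevel_iff, GLn.mem_glFiniteIntegralLevel_iff_forall_evalAt]
  simp only [mem_quatLocalPiInt_iff, quatFinAdelicEquiv_apply_coe]
  constructor
  · intro h v w
    exact h w.1
  · intro h w
    exact h (w.under (𝓞 ↥(maximalRealSubfield L))) ⟨w, rfl⟩

/-- The same, read on ★ #3f's matrix carrier: `g ∈ K_f ↔ ∀ v, quatLocalPiEquiv v (g_v) ∈ quatLocalUnitsLevel v`. [cite: PlatonovRapinchuk1994, §5.1] -/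
theorem mem_quatFinAdelicUnitsLevel_iff_forall_level (g : ↥(quatFinAdelicUnits L Ha)) :
    g ∈ quatFinAdelicUnitsLevel L Ha ↔
      ∀ v : HeightOneSpectrum (𝓞 ↥(maximalRealSubfield L)),
        ((quatLocalPiEquiv L Ha v (quatEvalPlace L Ha v g) : ↥(quatLocalUnits L Ha v)) : GL (Fin 2) (LocalRing L v)) ∈ quatLocalUnitsLevel L Ha v :=
  (mem_quatFinAdelicUnitsLevel_iff_forall L Ha g).trans
    (forall_congr' fun v => mem_quatLocalPiInt_iff_quatLocalPiEquiv_mem L Ha v _)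

/-- `K_f` is open in `(D_h ⊗ 𝔸_{L⁺,f})^×`. [cite: BorelJacquet1979, §4.1] -/
theorem isOpen_quatFinAdelicUnitsLevel : IsOpen (quatFinAdelicUnitsLevel L Ha : Set ↥(quatFinAdelicUnits L Ha)) :=
  (isOpen_glFiniteIntegralLevel 2 L).preimage continuous_subtype_val

/-- `(D_h ⊗ 𝔸_{L⁺,f})^×` is closed in `GL₂(𝔸_{L,f})` (its defining equation is closed: ★ `continuous_conjFiniteAdele`, continuity of transpose∕adjugate∕`Units.val`). [cite: PlatonovRapinchuk1994, §5.1] -/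
theorem isClosed_quatFinAdelicUnits : IsClosed (quatFinAdelicUnits L Ha : Set (GL (Fin 2) (FiniteAdeleRing (𝓞 L) L))) := by
  have h : (quatFinAdelicUnits L Ha : Set (GL (Fin 2) (FiniteAdeleRing (𝓞 L) L))) =
      {g | (((g : GL (Fin 2) (FiniteAdeleRing (𝓞 L) L)) : Matrix (Fin 2) (Fin 2) (FiniteAdeleRing (𝓞 L) L)).map
          (conjFiniteAdele (↥(maximalRealSubfield L)) L (IsCMField.complexConj L)))ᵀ * finiteAdelicForm L 2 Ha =
        finiteAdelicForm L 2 Ha * Matrix.adjugate ((g : GL (Fin 2) (FiniteAdeleRing (𝓞 L) L)) : Matrix (Fin 2) (Fin 2) (FiniteAdeleRing (𝓞 L) L))} :=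
    Set.ext fun g => mem_quatFinAdelicUnits_iff L Ha g
  haveI : T2Space (FiniteAdeleRing (𝓞 L) L) := inferInstanceAs <| T2Space
    (RestrictedProduct (fun w : HeightOneSpectrum (𝓞 L) => w.adicCompletion L)
      (fun w => (w.adicCompletionIntegers L : Set (w.adicCompletion L))) Filter.cofinite)
  have h1 : Continuous fun g : GL (Fin 2) (FiniteAdeleRing (𝓞 L) L) => (g : Matrix (Fin 2) (Fin 2) (FiniteAdeleRing (𝓞 L) L)) :=
    Units.continuous_val
  rw [h]
  refine isClosed_eq ?_ ?_
  · exact ((h1.matrix_map (continuous_conjFiniteAdele _ L _)).matrix_transpose).mul continuous_const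
  · exact continuous_const.mul h1.matrix_adjugate

/-- **`K_f` is compact** (closed `(D_h ⊗ 𝔸_{L⁺,f})^×` meets the compact `GL₂(𝒪̂_L)`, ★ `isCompact_glFiniteIntegralLevel_holds`). [cite: PlatonovRapinchuk1994, §5.1] -/
theorem isCompact_quatFinAdelicUnitsLevel : IsCompact (quatFinAdelicUnitsLevel L Ha : Set ↥(quatFinAdelicUnits L Ha)) :=
  (isClosed_quatFinAdelicUnits L Ha).isClosedEmbedding_subtypeVal.isCompact_preimage (isCompact_glFiniteIntegralLevel_holds 2 L)

/-! ## §5 Topological bookkeeping for the product Haar measure (ED. 3): local compactness and second countability -/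

/-- `(D_v)^×` (factor carrier) is locally compact (closed in the locally compact `Π_{w∣v} GL₂(L_w)`, ★ `locallyCompactSpace_gl_adicCompletion`). [cite: PlatonovRapinchuk1994, §5.1] -/
theorem locallyCompactSpace_quatLocalPi : LocallyCompactSpace ↥(quatLocalPi L Ha v) := by
  haveI : ∀ w : PlacesOver L v, LocallyCompactSpace (GL (Fin 2) (w.1.adicCompletion L)) := fun w => locallyCompactSpace_gl_adicCompletion L 2 w.1
  haveI : LocallyCompactSpace (LocalGLPi L 2 v) := inferInstance
  exact (isClosed_quatLocalPi L Ha v).isClosedEmbedding_subtypeVal.locallyCompactSpace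

/-- `(D_v)^×` (factor carrier) is second countable (★ `secondCountableTopology_gl_adicCompletion`). [cite: PlatonovRapinchuk1994, §5.1] -/
theorem secondCountableTopology_quatLocalPi : SecondCountableTopology ↥(quatLocalPi L Ha v) := by
  haveI : ∀ w : PlacesOver L v, SecondCountableTopology (GL (Fin 2) (w.1.adicCompletion L)) := fun w => secondCountableTopology_gl_adicCompletion L 2 w.1
  haveI : SecondCountableTopology (LocalGLPi L 2 v) := inferInstance
  exact TopologicalSpace.Subtype.secondCountableTopology _

/-- **The restricted product `∏'_v ((D_v)^× : Λ_v^×)` is locally compact** (Mathlib `RestrictedProduct.locallyCompactSpace_of_group`: the `Λ_v^×` are compact open, the `(D_v)^×` locally compact).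
[cite: PlatonovRapinchuk1994, §5.1] -/
theorem locallyCompactSpace_restrictedProduct :
    LocallyCompactSpace (Πʳ v : HeightOneSpectrum (𝓞 ↥(maximalRealSubfield L)), [↥(quatLocalPi L Ha v), quatLocalPiInt L Ha v]) := by
  haveI := fun v => locallyCompactSpace_quatLocalPi L Ha v
  exact RestrictedProduct.locallyCompactSpace_of_group _ (Eventually.of_forall fun v => isCompact_quatLocalPiInt L Ha v)

/-- **`(D_h ⊗ 𝔸_{L⁺,f})^×` is locally compact** (transport along `quatFinAdelicEquiv`). [cite: PlatonovRapinchuk1994, §5.1] -/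
theorem locallyCompactSpace_quatFinAdelicUnits : LocallyCompactSpace ↥(quatFinAdelicUnits L Ha) := by
  haveI := locallyCompactSpace_restrictedProduct L Ha
  exact (quatFinAdelicEquiv L Ha).toHomeomorph.isClosedEmbedding.locallyCompactSpace

end Summit.HodgeConjecture.HodgeConjecture.Cruxes.H413.K2E5QuatAdelicRestrictedProduct

end
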